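import Mathlib

/-!
HONEST FRAMING: exact (Metropolis-corrected) sampling algorithms for lattice gauge theory; figures
of merit are autocorrelation/cost numbers at stated couplings and volumes; no continuum-physics
claim.

# SwapAcceptanceLaw — THE REPLICA-EXCHANGE / INDEPENDENCE-METROPOLIS ACCEPTANCE LAW OF A ONE-PARAMETER
# EXPONENTIAL FAMILY: `exp(−|t−s|·√(Var_s + Var_t + (m_s − m_t)²)) ≤ A(s,t) ≤ exp(−(ψ(s) + ψ(t) − 2ψ((s+t)/2)))`
# (lean-2 GEN-11, ours; part 1 of 2 — the floor/ceiling forms and the ladder law are `SwapAcceptanceLadder`)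

Venture-side (OURS).  Cell `lqcd-flow` (pub-lqcd), unit `pub-lqcd-lean-2-g11`, 2026-08-23.  Measure level,
abstract: `μ` a probability measure on `Ω`, `X : Ω → ℝ` bounded measurable, the exponential family
`μ_u := μ.tilted (u·X)` (density `e^{uX − ψ(u)}`, `ψ = cgf X μ = log mgf`), so that `∫ X dμ_u = ψ′(u)`,
`Var_{μ_u}(X) = ψ″(u)` (Mathlib `integral_tilted_mul_self`, `variance_tilted_mul`).

* §1 `swapAcc X μ s t := ∫∫ min(1, e^{(t−s)(X x − X y)}) dμ_s(x) dμ_t(y)` — the mean acceptance of the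
  replica-exchange (parallel-tempering) swap `(x, y) ↦ (y, x)` between the parameters `s` and `t` at
  stationarity (the swap is exact: `Exactness/PTBCSwap.lean`, `involAccept_ptbcSwap`); by Fubini it is ALSO the
  stationary mean acceptance of the independence Metropolis sampler with target `μ_t` and proposal `μ_s`
  (`swapAcc_eq_imh`).  `0 ≤ swapAcc ≤ 1`.
* §2 **CEILING (exact Bhattacharyya form)**: `swapAcc ≤ E_s[e^{hX}]·E_t[e^{−hX}] = exp(2ψ(m) − ψ(s) − ψ(t))`,
  `h = (t−s)/2`, `m = (s+t)/2` (`min(1,e^z) ≤ e^{z/2}`; the right side is the squared Bhattacharyya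
  coefficient of `μ_s, μ_t` — the measure-level twin of the finite `Theory2.accRate_le_bhatt_sq`)
  (`swapAcc_le_exp_midpoint_gap`).
* §3 **FLOOR (Jensen)**: `swapAcc ≥ exp(−∫∫|(t−s)(X x − X y)|) ≥ exp(−|t−s|·√(Var_s + Var_t + (m_s − m_t)²))`
  (`min(1,e^z) ≥ e^{−|z|}`, Jensen for `exp`, Cauchy–Schwarz, and the exact second moment
  `∫∫(X x − X y)² = Var_s + Var_t + (m_s − m_t)²`) (`swapAcc_ge_exp_neg`).
* Sequel `Scaling/SwapAcceptanceLadder`: the variance FLOOR / CEILING forms `exp(−(δ√(2M) + Mδ²)) ≤ swapAcc ≤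
  exp(−mδ²/4)` and the replica-ladder count law `Θ((b−a)·√(variance scale))`.

Docking (`TrivializingMaps/CouplingLadderLawAnyGroup`): `X = −S_W^ρ`, `μ = D[U]`, `μ_u = wilsonMeasure ρ u`
for every compact gauge group, with the tree's variance floors (`e^{−c|β|}⌊L/2⌋^d v_ρ` at every coupling,
`v_ρ#plaq/2` at strong coupling, `c#plaq/(1+u²)` for `SU(n)`) and ceiling (`32#plaq/r²` at strong coupling):
parallel tempering in the coupling needs `Θ((b−a)√#plaq)` replicas.  The same functional with `X = −S_D`
(defect action) and base `e^{−βS_{Dᶜ}}D[U]` is the boundary-condition-tempering (PTBC) swap, docked to lean-1's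
`Theory2.DefectFloor.defect_variance_floor`.

Literature grade (cell rule): KNOWN MECHANISM — the `√N`-replica rule of parallel tempering (Hukushima–Nemoto
1996; Kofke 2002; Predescu–Predescu–Ciobanu 2004 "incomplete beta-function law"; Katzgraber arXiv:0905.1629 p. 21:
`ΔT ∼ c_V T/√N`, `M ∼ √N`), `acc ≤ BC²` (the tree's T2-M), and the swap-rejection functional of non-reversible PT
(Syed–Bouchard-Côté–Deligiannidis–Doucet, JRSSB 2022); NEW TYPING: rigorous two-sided constants at measure level
for an arbitrary bounded exponential family, nothing cited as a fact.  NOT CLAIMED: round-trip / mixing times of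
the replica process; optimal (non-uniform) ladders; anything finite-sample.
-/

noncomputable section

open MeasureTheory ProbabilityTheory Real Set Filter Topology

namespace Summit.Ventures.LatticeQCDFlow.Scaling

/-! ## §1 The bounded exponential family and the swap acceptance functional -/

section Family

variable {Ω : Type*} [MeasurableSpace Ω] {μ : Measure Ω} {X : Ω → ℝ}

/-- A bounded measurable function on a finite measure space is integrable. [folklore] -/
theorem integrable_of_abs_le {ν : Measure Ω} [IsFiniteMeasure ν] {f : Ω → ℝ} (hf : Measurable f)
    {C : ℝ} (hC : ∀ ω, |f ω| ≤ C) : Integrable f ν :=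
  (integrable_const C).mono' hf.aestronglyMeasurable
    (ae_of_all _ fun ω => by rw [Real.norm_eq_abs]; exact hC ω)

/-- `e^{uX}` is integrable for every real `u` when `X` is bounded measurable. [folklore] -/
theorem integrable_exp_mul_of_bounded [IsFiniteMeasure μ] (hXm : Measurable X)
    (hXb : ∃ C, ∀ ω, |X ω| ≤ C) (u : ℝ) : Integrable (fun ω => exp (u * X ω)) μ := by
  obtain ⟨C, hC⟩ := hXb
  refine integrable_of_abs_le (measurable_const.mul hXm).exp (C := exp (|u| * C)) fun ω => ?_
  rw [abs_of_pos (exp_pos _), exp_le_exp]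
  calc u * X ω ≤ |u * X ω| := le_abs_self _
    _ = |u| * |X ω| := abs_mul _ _
    _ ≤ |u| * C := mul_le_mul_of_nonneg_left (hC ω) (abs_nonneg _)

/-- Every real `u` is interior to the domain of the MGF of a bounded `X`. [folklore] -/
theorem mem_interior_integrableExpSet_of_bounded [IsFiniteMeasure μ] (hXm : Measurable X)
    (hXb : ∃ C, ∀ ω, |X ω| ≤ C) (u : ℝ) : u ∈ interior (integrableExpSet X μ) := by
  have huniv : integrableExpSet X μ = univ :=
    eq_univ_of_forall fun v => integrable_exp_mul_of_bounded hXm hXb v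
  rw [huniv, interior_univ]; exact mem_univ u

/-- Each member `μ_u = μ.tilted(u·X)` of the family is a probability measure. [folklore] -/
theorem isProbabilityMeasure_tilted_mul [IsProbabilityMeasure μ] (hXm : Measurable X)
    (hXb : ∃ C, ∀ ω, |X ω| ≤ C) (u : ℝ) : IsProbabilityMeasure (μ.tilted fun ω => u * X ω) :=
  isProbabilityMeasure_tilted (integrable_exp_mul_of_bounded hXm hXb u)

/-- **`E_{μ_s}[e^{uX}] = mgf(s+u)/mgf(s)`** — the exponential moments of a tilted measure. [folklore] -/
theorem integral_exp_mul_tilted (s u : ℝ) :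
    ∫ ω, exp (u * X ω) ∂(μ.tilted fun ω => s * X ω) = mgf X μ (s + u) / mgf X μ s := by
  rw [integral_tilted_mul_eq_mgf]
  have h : ∀ ω, (exp (s * X ω) / mgf X μ s) • exp (u * X ω) = (mgf X μ s)⁻¹ * exp ((s + u) * X ω) := by
    intro ω
    rw [smul_eq_mul, add_mul, exp_add]
    ring
  simp_rw [h]
  rw [integral_const_mul]
  rw [show (∫ ω, exp ((s + u) * X ω) ∂μ) = mgf X μ (s + u) from rfl]
  rw [inv_mul_eq_div]

/-- `∫ X dμ_u = ψ′(u)` (`ψ = cgf X μ`). [folklore] -/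
theorem integral_tilted_eq_deriv_cgf [IsProbabilityMeasure μ] (hXm : Measurable X)
    (hXb : ∃ C, ∀ ω, |X ω| ≤ C) (u : ℝ) :
    ∫ ω, X ω ∂(μ.tilted fun ω => u * X ω) = deriv (cgf X μ) u :=
  integral_tilted_mul_self (mem_interior_integrableExpSet_of_bounded hXm hXb u)

/-- `ψ = cgf X μ` is real-analytic on `ℝ`. [folklore] -/
theorem analyticOnNhd_cgf_of_bounded [IsProbabilityMeasure μ] (hXm : Measurable X)
    (hXb : ∃ C, ∀ ω, |X ω| ≤ C) : AnalyticOnNhd ℝ (cgf X μ) univ := fun u _ =>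
  analyticAt_cgf (mem_interior_integrableExpSet_of_bounded hXm hXb u)

/-- `ψ` has derivative `ψ′` everywhere. [folklore] -/
theorem hasDerivAt_cgf_of_bounded [IsProbabilityMeasure μ] (hXm : Measurable X)
    (hXb : ∃ C, ∀ ω, |X ω| ≤ C) (u : ℝ) :
    HasDerivAt (cgf X μ) (deriv (cgf X μ) u) u :=
  ((analyticOnNhd_cgf_of_bounded hXm hXb) u (mem_univ u)).differentiableAt.hasDerivAt

/-- **`ψ′` has derivative `ψ″(u) = Var_{μ_u}(X)` everywhere.** [folklore] -/
theorem hasDerivAt_deriv_cgf_of_bounded [IsProbabilityMeasure μ] (hXm : Measurable X)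
    (hXb : ∃ C, ∀ ω, |X ω| ≤ C) (u : ℝ) :
    HasDerivAt (deriv (cgf X μ)) (variance X (μ.tilted fun ω => u * X ω)) u := by
  have hA := (analyticOnNhd_cgf_of_bounded (μ := μ) hXm hXb).deriv
  have h := (hA u (mem_univ u)).differentiableAt.hasDerivAt
  rw [variance_tilted_mul (mem_interior_integrableExpSet_of_bounded hXm hXb u), iteratedDeriv_succ,
    iteratedDeriv_one]
  exact h

/-- `0 < mgf X μ u`. [folklore] -/
theorem mgf_pos_of_bounded [IsProbabilityMeasure μ] (hXm : Measurable X)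
    (hXb : ∃ C, ∀ ω, |X ω| ≤ C) (u : ℝ) : 0 < mgf X μ u :=
  mgf_pos (integrable_exp_mul_of_bounded hXm hXb u)

/-- **The swap / independence-Metropolis acceptance functional of the exponential family `μ_u = μ.tilted(u·X)`:**
`swapAcc X μ s t = ∫∫ min(1, e^{(t−s)(X x − X y)}) dμ_s(x) dμ_t(y)` — the stationary mean acceptance of the
replica-exchange swap `(x,y) ↦ (y,x)` for the product target `μ_s ⊗ μ_t` (the Metropolis ratio of the swap is
`e^{(t−s)(X x − X y)}`), equivalently (`swapAcc_eq_imh`) of the independence sampler with target `μ_t` and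
proposal `μ_s`. [ours] -/
def swapAcc (X : Ω → ℝ) (μ : Measure Ω) (s t : ℝ) : ℝ :=
  ∫ p, min 1 (exp ((t - s) * (X p.1 - X p.2)))
    ∂((μ.tilted fun ω => s * X ω).prod (μ.tilted fun ω => t * X ω))

/-- The integrand `min(1, e^{(t−s)(X x − X y)})` is measurable. [folklore] -/
theorem measurable_swapIntegrand (hXm : Measurable X) (s t : ℝ) :
    Measurable fun p : Ω × Ω => min 1 (exp ((t - s) * (X p.1 - X p.2))) :=
  measurable_const.min
    (measurable_const.mul ((hXm.comp measurable_fst).sub (hXm.comp measurable_snd))).exp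

omit [MeasurableSpace Ω] in
/-- `0 ≤ min(1, e^z) ≤ 1`. [folklore] -/
theorem swapIntegrand_mem_Icc (s t : ℝ) (p : Ω × Ω) :
    min 1 (exp ((t - s) * (X p.1 - X p.2))) ∈ Icc (0 : ℝ) 1 :=
  ⟨le_min zero_le_one (exp_pos _).le, min_le_left _ _⟩

/-- `0 ≤ swapAcc`. [ours] -/
theorem swapAcc_nonneg (s t : ℝ) : 0 ≤ swapAcc X μ s t :=
  integral_nonneg fun p => (swapIntegrand_mem_Icc s t p).1

/-- `swapAcc ≤ 1`. [ours] -/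
theorem swapAcc_le_one [IsProbabilityMeasure μ] (hXm : Measurable X) (hXb : ∃ C, ∀ ω, |X ω| ≤ C)
    (s t : ℝ) : swapAcc X μ s t ≤ 1 := by
  haveI := isProbabilityMeasure_tilted_mul (μ := μ) hXm hXb s
  haveI := isProbabilityMeasure_tilted_mul (μ := μ) hXm hXb t
  unfold swapAcc
  calc ∫ p, min 1 (exp ((t - s) * (X p.1 - X p.2)))
        ∂((μ.tilted fun ω => s * X ω).prod (μ.tilted fun ω => t * X ω))
      ≤ ∫ _p, (1 : ℝ) ∂((μ.tilted fun ω => s * X ω).prod (μ.tilted fun ω => t * X ω)) :=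
        integral_mono_of_nonneg (ae_of_all _ fun p => (swapIntegrand_mem_Icc s t p).1)
          (integrable_const _) (ae_of_all _ fun p => (swapIntegrand_mem_Icc s t p).2)
    _ = 1 := by rw [integral_const, smul_eq_mul, mul_one, probReal_univ]

/-- **IMH READING**: `swapAcc X μ s t = ∫∫ min(1, e^{(t−s)(X y − X x)}) dμ_t(x) dμ_s(y)` — for `x ~ μ_t`
(target, at stationarity) and an independent proposal `y ~ μ_s`, the Metropolis–Hastings acceptance
`min(1, w(y)/w(x))`, `w = dμ_t/dμ_s ∝ e^{(t−s)X}`, has the same mean (Fubini). [ours] -/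
theorem swapAcc_eq_imh (s t : ℝ) :
    swapAcc X μ s t = ∫ p, min 1 (exp ((t - s) * (X p.2 - X p.1)))
      ∂((μ.tilted fun ω => t * X ω).prod (μ.tilted fun ω => s * X ω)) := by
  unfold swapAcc
  rw [← integral_prod_swap]
  rfl

end Family

/-! ## §2 The ceiling: `swapAcc ≤ exp(2ψ((s+t)/2) − ψ(s) − ψ(t))` (squared Bhattacharyya coefficient) -/

section Ceiling

variable {Ω : Type*} [MeasurableSpace Ω] {μ : Measure Ω} [IsProbabilityMeasure μ] {X : Ω → ℝ}

/-- `min(1, e^z) ≤ e^{z/2}`. [folklore] -/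
theorem min_one_exp_le_exp_half (z : ℝ) : min 1 (exp z) ≤ exp (z / 2) := by
  rcases le_or_gt 0 z with hz | hz
  · exact (min_le_left _ _).trans (one_le_exp (by linarith))
  · exact (min_le_right _ _).trans (exp_le_exp.2 (by linarith))

/-- **CEILING (exact Bhattacharyya form): `swapAcc ≤ exp(2ψ((s+t)/2) − ψ(s) − ψ(t))`**, `ψ = cgf X μ`.
Proof: `min(1,e^z) ≤ e^{z/2}`, the bound factorises over the product, and `E_{μ_s}[e^{hX}] = e^{ψ(s+h)−ψ(s)}`,
`E_{μ_t}[e^{−hX}] = e^{ψ(t−h)−ψ(t)}` with `h = (t−s)/2`, `s + h = t − h = (s+t)/2`. [ours] -/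
theorem swapAcc_le_exp_midpoint_gap (hXm : Measurable X) (hXb : ∃ C, ∀ ω, |X ω| ≤ C) (s t : ℝ) :
    swapAcc X μ s t ≤ exp (2 * cgf X μ ((s + t) / 2) - cgf X μ s - cgf X μ t) := by
  haveI := isProbabilityMeasure_tilted_mul (μ := μ) hXm hXb s
  haveI := isProbabilityMeasure_tilted_mul (μ := μ) hXm hXb t
  set h : ℝ := (t - s) / 2 with hh
  set f : Ω → ℝ := fun x => exp (h * X x) with hf
  set g : Ω → ℝ := fun y => exp ((-h) * X y) with hg
  have hfi : Integrable f (μ.tilted fun ω => s * X ω) := by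
    obtain ⟨C, hC⟩ := hXb
    exact integrable_exp_mul_of_bounded (μ := μ.tilted fun ω => s * X ω) hXm ⟨C, hC⟩ h
  have hgi : Integrable g (μ.tilted fun ω => t * X ω) := by
    obtain ⟨C, hC⟩ := hXb
    exact integrable_exp_mul_of_bounded (μ := μ.tilted fun ω => t * X ω) hXm ⟨C, hC⟩ (-h)
  -- pointwise bound and integration
  have hpt : ∀ p : Ω × Ω, min 1 (exp ((t - s) * (X p.1 - X p.2))) ≤ f p.1 * g p.2 := by
    intro p
    refine (min_one_exp_le_exp_half _).trans (le_of_eq ?_)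
    rw [hf, hg, ← exp_add]
    congr 1
    rw [hh]; ring
  have hle : swapAcc X μ s t ≤ ∫ p, f p.1 * g p.2
      ∂((μ.tilted fun ω => s * X ω).prod (μ.tilted fun ω => t * X ω)) := by
    unfold swapAcc
    refine integral_mono_of_nonneg (ae_of_all _ fun p => (swapIntegrand_mem_Icc s t p).1)
      (hfi.mul_prod hgi) (ae_of_all _ hpt)
  refine hle.trans (le_of_eq ?_)
  rw [integral_prod_mul, hf, hg, integral_exp_mul_tilted (μ := μ) (X := X), integral_exp_mul_tilted (μ := μ) (X := X)]
  have h1 : s + h = (s + t) / 2 := by rw [hh]; ring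
  have h2 : t + -h = (s + t) / 2 := by rw [hh]; ring
  rw [h1, h2]
  have hZ : ∀ u, mgf X μ u = exp (cgf X μ u) := fun u =>
    (exp_cgf (integrable_exp_mul_of_bounded hXm hXb u)).symm
  rw [hZ, hZ, hZ, ← exp_sub, ← exp_sub, ← exp_add]
  congr 1
  ring

end Ceiling

/-! ## §3 The floor: `swapAcc ≥ exp(−|t−s|·√(Var_s + Var_t + (m_s − m_t)²))` (Jensen) -/

section Floor

variable {Ω : Type*} [MeasurableSpace Ω] {μ : Measure Ω} [IsProbabilityMeasure μ] {X : Ω → ℝ}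

/-- `e^{−|z|} ≤ min(1, e^z)`. [folklore] -/
theorem exp_neg_abs_le_min_one_exp (z : ℝ) : exp (-|z|) ≤ min 1 (exp z) := by
  refine le_min ?_ (exp_le_exp.2 (neg_abs_le z))
  rw [← exp_zero]; exact exp_le_exp.2 (neg_nonpos.2 (abs_nonneg z))

/-- **EXACT SECOND MOMENT OF THE ACTION DIFFERENCE ACROSS THE PAIR**:
`∫∫ (X x − X y)² dμ_s dμ_t = Var_s + Var_t + (m_s − m_t)²`. [folklore] -/
theorem integral_sub_sq_prod_tilted (hXm : Measurable X) (hXb : ∃ C, ∀ ω, |X ω| ≤ C) (s t : ℝ) :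
    ∫ p, (X p.1 - X p.2) ^ 2 ∂((μ.tilted fun ω => s * X ω).prod (μ.tilted fun ω => t * X ω)) =
      variance X (μ.tilted fun ω => s * X ω) + variance X (μ.tilted fun ω => t * X ω) +
        ((∫ ω, X ω ∂(μ.tilted fun ω => s * X ω)) - ∫ ω, X ω ∂(μ.tilted fun ω => t * X ω)) ^ 2 := by
  set νs := μ.tilted fun ω => s * X ω with hνs
  set νt := μ.tilted fun ω => t * X ω with hνt
  haveI : IsProbabilityMeasure νs := isProbabilityMeasure_tilted_mul (μ := μ) hXm hXb s
  haveI : IsProbabilityMeasure νt := isProbabilityMeasure_tilted_mul (μ := μ) hXm hXb t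
  obtain ⟨C, hC⟩ := hXb
  -- the difference `W p = X p.1 + (−X) p.2`
  set W : Ω × Ω → ℝ := fun p => X p.1 - X p.2 with hW
  have hWm : Measurable W := (hXm.comp measurable_fst).sub (hXm.comp measurable_snd)
  have hWb : ∀ p, |W p| ≤ 2 * C := fun p => by
    rw [hW]
    calc |X p.1 - X p.2| ≤ |X p.1| + |X p.2| := abs_sub _ _
      _ ≤ C + C := add_le_add (hC _) (hC _)
      _ = 2 * C := by ring
  have hWmem : MemLp W 2 (νs.prod νt) :=
    memLp_of_bounded (a := -(2 * C)) (b := 2 * C)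
      (ae_of_all _ fun p => ⟨(abs_le.1 (hWb p)).1, (abs_le.1 (hWb p)).2⟩) hWm.aestronglyMeasurable 2
  have hXs : MemLp X 2 νs :=
    memLp_of_bounded (a := -C) (b := C) (ae_of_all _ fun ω => ⟨(abs_le.1 (hC ω)).1, (abs_le.1 (hC ω)).2⟩)
      hXm.aestronglyMeasurable 2
  have hXt : MemLp (fun ω => -X ω) 2 νt := by
    refine memLp_of_bounded (a := -C) (b := C) (ae_of_all _ fun ω => ?_)
      (hXm.neg.aestronglyMeasurable) 2
    have h1 := (abs_le.1 (hC ω)).1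
    have h2 := (abs_le.1 (hC ω)).2
    simp only [Set.mem_Icc, Pi.neg_apply]
    constructor <;> linarith
  -- `Var W = Var_s + Var_t`
  have hvar : variance W (νs.prod νt) = variance X νs + variance X νt := by
    have h := variance_add_prod hXs hXt
    rw [variance_fun_neg] at h
    rw [← h]
    rfl
  -- `∫ W = m_s − m_t`
  have hmean : ∫ p, W p ∂(νs.prod νt) = (∫ ω, X ω ∂νs) - ∫ ω, X ω ∂νt := by
    rw [hW]
    rw [integral_sub ((integrable_of_abs_le hXm hC).comp_fst νt)
      ((integrable_of_abs_le hXm hC).comp_snd νs)]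
    rw [integral_fun_fst, integral_fun_snd, probReal_univ, probReal_univ, one_smul, one_smul]
  -- `∫ W² = Var W + (∫ W)²`
  have hsq : ∫ p, (W p) ^ 2 ∂(νs.prod νt) = variance W (νs.prod νt) + (∫ p, W p ∂(νs.prod νt)) ^ 2 := by
    rw [variance_eq_sub hWmem]
    simp only [Pi.pow_apply]
    ring
  rw [show (fun p : Ω × Ω => (X p.1 - X p.2) ^ 2) = fun p => (W p) ^ 2 from rfl, hsq, hvar, hmean]

/-- **FLOOR (Jensen): `exp(−|t−s|·√(Var_s + Var_t + (m_s − m_t)²)) ≤ swapAcc`** — `min(1,e^z) ≥ e^{−|z|}`,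
Jensen's inequality for `exp`, and `(∫|Z|)² ≤ ∫ Z²` with the exact second moment of §3. [ours] -/
theorem swapAcc_ge_exp_neg (hXm : Measurable X) (hXb : ∃ C, ∀ ω, |X ω| ≤ C) (s t : ℝ) :
    exp (-(|t - s| * sqrt (variance X (μ.tilted fun ω => s * X ω) +
        variance X (μ.tilted fun ω => t * X ω) +
        ((∫ ω, X ω ∂(μ.tilted fun ω => s * X ω)) - ∫ ω, X ω ∂(μ.tilted fun ω => t * X ω)) ^ 2))) ≤
      swapAcc X μ s t := by
  set νs := μ.tilted fun ω => s * X ω with hνs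
  set νt := μ.tilted fun ω => t * X ω with hνt
  haveI : IsProbabilityMeasure νs := isProbabilityMeasure_tilted_mul (μ := μ) hXm hXb s
  haveI : IsProbabilityMeasure νt := isProbabilityMeasure_tilted_mul (μ := μ) hXm hXb t
  have h2nd := integral_sub_sq_prod_tilted (μ := μ) hXm hXb s t
  obtain ⟨C, hC⟩ := hXb
  set P := νs.prod νt with hP
  set Z : Ω × Ω → ℝ := fun p => (t - s) * (X p.1 - X p.2) with hZ
  have hZm : Measurable Z := measurable_const.mul ((hXm.comp measurable_fst).sub (hXm.comp measurable_snd))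
  have hZb : ∀ p, |Z p| ≤ |t - s| * (2 * C) := fun p => by
    rw [hZ, abs_mul]
    refine mul_le_mul_of_nonneg_left ?_ (abs_nonneg _)
    calc |X p.1 - X p.2| ≤ |X p.1| + |X p.2| := abs_sub _ _
      _ ≤ C + C := add_le_add (hC _) (hC _)
      _ = 2 * C := by ring
  have hZi : Integrable Z P := integrable_of_abs_le hZm hZb
  have hZai : Integrable (fun p => |Z p|) P := hZi.abs
  -- step 1: `swapAcc ≥ ∫ exp(−|Z|)`
  have h1 : ∫ p, exp (-|Z p|) ∂P ≤ swapAcc X μ s t := by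
    unfold swapAcc
    refine integral_mono_of_nonneg (ae_of_all _ fun p => (exp_pos _).le)
      (integrable_of_abs_le (measurable_swapIntegrand hXm s t) (C := 1) fun p => ?_)
      (ae_of_all _ fun p => exp_neg_abs_le_min_one_exp (Z p))
    rw [abs_of_nonneg (swapIntegrand_mem_Icc s t p).1]
    exact (swapIntegrand_mem_Icc s t p).2
  -- step 2: Jensen `exp(−∫|Z|) ≤ ∫ exp(−|Z|)`
  have h2 : exp (∫ p, -|Z p| ∂P) ≤ ∫ p, exp (-|Z p|) ∂P := by
    have hgi : Integrable (exp ∘ fun p => -|Z p|) P := by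
      refine integrable_of_abs_le (hZm.abs.neg.exp) (C := 1) fun p => ?_
      simp only [Function.comp_apply]
      rw [abs_of_pos (exp_pos _), ← exp_zero]
      exact exp_le_exp.2 (neg_nonpos.2 (abs_nonneg _))
    exact ConvexOn.map_integral_le convexOn_exp continuousOn_exp isClosed_univ
      (ae_of_all _ fun p => mem_univ _) hZai.neg hgi
  -- step 3: `∫|Z| ≤ √(∫ Z²) = |t−s| √(…)`
  have hZmem : MemLp (fun p => |Z p|) 2 P :=
    memLp_of_bounded (a := -(|t - s| * (2 * C))) (b := |t - s| * (2 * C))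
      (ae_of_all _ fun p => ⟨by linarith [abs_nonneg (Z p), hZb p], hZb p⟩)
      hZm.abs.aestronglyMeasurable 2
  have h3 : (∫ p, |Z p| ∂P) ^ 2 ≤ ∫ p, (Z p) ^ 2 ∂P := by
    have hv := variance_nonneg (fun p => |Z p|) P
    rw [variance_eq_sub hZmem] at hv
    have : ∫ p, ((fun p => |Z p|) ^ 2) p ∂P = ∫ p, (Z p) ^ 2 ∂P :=
      integral_congr_ae (ae_of_all _ fun p => by simp [sq_abs])
    linarith
  have hZsq : ∫ p, (Z p) ^ 2 ∂P = (t - s) ^ 2 * ∫ p, (X p.1 - X p.2) ^ 2 ∂P := by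
    rw [← integral_const_mul]
    refine integral_congr_ae (ae_of_all _ fun p => ?_)
    rw [hZ]; ring
  have h4 : ∫ p, |Z p| ∂P ≤ |t - s| * sqrt (variance X νs + variance X νt +
      ((∫ ω, X ω ∂νs) - ∫ ω, X ω ∂νt) ^ 2) := by
    have hnn : 0 ≤ ∫ p, |Z p| ∂P := integral_nonneg fun p => abs_nonneg _
    rw [← sqrt_sq (abs_nonneg (t - s)), ← sqrt_mul (sq_nonneg _), sq_abs]
    refine (Real.le_sqrt hnn (mul_nonneg (sq_nonneg _)
      (add_nonneg (add_nonneg (variance_nonneg _ _) (variance_nonneg _ _)) (sq_nonneg _)))).2 ?_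
    rw [← h2nd, ← hZsq]
    exact h3
  -- assemble
  calc exp (-(|t - s| * sqrt (variance X νs + variance X νt + ((∫ ω, X ω ∂νs) - ∫ ω, X ω ∂νt) ^ 2)))
      ≤ exp (∫ p, -|Z p| ∂P) := by
        rw [integral_neg]
        exact exp_le_exp.2 (neg_le_neg h4)
    _ ≤ ∫ p, exp (-|Z p|) ∂P := h2
    _ ≤ swapAcc X μ s t := h1

end Floor

end Summit.Ventures.LatticeQCDFlow.Scaling

end
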